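import Summits.AtomisticToContinuum.Crystallization.Theorems.SquareWellLayerCakeGapTwelveToBarlowFiveFoldContinuationFrame

/-!
# Five-fold continuation (S2β) — part 2: disjoint rings and the reduction of the far case

Crux `SquareWellLayerCake.GapTwelveToBarlow` (stmt-AtomisticToContinuum-15807), line `Sketch`.
`stub_fiveFoldContinuation` is the conjunction of three parts (file
`…FiveFoldContinuationOfParts`: ADJ — no adjacent five-fold bonds; FAR — far five-fold bonds
are antipodal; EX — a second five-fold bond exists).  Granted ADJ, the overlap lemma of part 1
upgrades the hypotheses available to a prover of FAR:

* `disjoint_rings_of_noAdjacent` — the rings of two five-fold bonds at `j` are disjoint;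
* `card_common_le_four_of_mem_ring` — no ring site carries a five-fold bond with `j`;
* `mem_rings_of_far_fiveFold` — at a Good site (twelve neighbours) the neighbourhood is
  exactly `{k} ⊔ ring(k) ⊔ ring(k') ⊔ {k'}` (`1 + 5 + 5 + 1 = 12`);
* `far_of_noAdjacent_of_farDisjoint` / `stub_farOfFarDisjoint` — hence
  (ADJ) ∧ (FAR-disjoint) ⇒ (FAR), where FAR-disjoint is FAR with these three facts added as
  hypotheses (the `1+5+5+1` lever of the brief).

Mathlib + part 1 only; no named fact is used.
-/

noncomputable section

namespace Summit.AtomisticToContinuum.Crystallization.Theorems.SquareWellLayerCakeGapTwelveToBarlow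

open scoped InnerProductSpace ComplexConjugate Real

/-! ## Consequences under "no adjacent five-fold bonds" -/

/-- **Disjoint rings.**  If at the site `j` no five-fold bond is adjacent to the five-fold
bond `(j, k)` (every other five-fold bond `(j, k'')` has `|x k - x k''| > 1`), then the ring of
`(j, k)` is disjoint from the ring of any other five-fold bond `(j, k')`. [folklore] -/
theorem disjoint_rings_of_noAdjacent {N : ℕ} (x : Fin N → EuclideanSpace ℝ (Fin 3))
    (j k k' : Fin N)
    (hsep : ∀ j' : Fin N, dist (x j) (x j') ≤ 11 / 10 → ∀ k'' : Fin N, k'' ≠ j' →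
      (55 : ℝ) / 57 ≤ dist (x j') (x k''))
    (hgap : ∀ l l' : Fin N, dist (x j) (x l) ≤ 1 → dist (x j) (x l') ≤ 1 →
      1 < dist (x l) (x l') → (131 : ℝ) / 100 ≤ dist (x l) (x l'))
    (hjk : j ≠ k) (hdjk : dist (x j) (x k) ≤ 1)
    (h5 : (Finset.univ.filter fun l : Fin N =>
        l ≠ j ∧ l ≠ k ∧ dist (x j) (x l) ≤ 1 ∧ dist (x k) (x l) ≤ 1).card = 5)
    (hADJ : ∀ k'' : Fin N, k'' ≠ j → k'' ≠ k → dist (x j) (x k'') ≤ 1 →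
      (Finset.univ.filter fun l : Fin N =>
        l ≠ j ∧ l ≠ k'' ∧ dist (x j) (x l) ≤ 1 ∧ dist (x k'') (x l) ≤ 1).card = 5 →
      1 < dist (x k) (x k''))
    (hjk' : j ≠ k') (hdjk' : dist (x j) (x k') ≤ 1)
    (h5' : (Finset.univ.filter fun l : Fin N =>
        l ≠ j ∧ l ≠ k' ∧ dist (x j) (x l) ≤ 1 ∧ dist (x k') (x l) ≤ 1).card = 5)
    (hkk' : k' ≠ k) :
    Disjoint
      (Finset.univ.filter fun l : Fin N =>
        l ≠ j ∧ l ≠ k ∧ dist (x j) (x l) ≤ 1 ∧ dist (x k) (x l) ≤ 1)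
      (Finset.univ.filter fun l : Fin N =>
        l ≠ j ∧ l ≠ k' ∧ dist (x j) (x l) ≤ 1 ∧ dist (x k') (x l) ≤ 1) := by
  classical
  have hfar : 1 < dist (x k) (x k') := hADJ k' hjk'.symm hkk' hdjk' h5'
  rw [Finset.disjoint_left]
  intro w hw hw'
  have hw5 := card_eq_five_of_mem_inter x j k k' hsep hgap hjk hdjk h5 hjk' hdjk' h5' hfar w hw hw'
  obtain ⟨hwj, hwk, hdjw, hdkw⟩ := (Finset.mem_filter.mp hw).2
  have h := hADJ w hwj hwk hdjw hw5
  exact absurd hdkw (not_le.mpr h)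

/-- **Ring sites carry no five-fold bond** (under "no adjacent five-fold bonds"): every common
neighbour `w` of the five-fold bond `(j, k)` has at most four common neighbours with `j`.
[folklore] -/
theorem card_common_le_four_of_mem_ring {N : ℕ} (x : Fin N → EuclideanSpace ℝ (Fin 3))
    (j k : Fin N)
    (hsep : ∀ j' : Fin N, dist (x j) (x j') ≤ 11 / 10 → ∀ k'' : Fin N, k'' ≠ j' →
      (55 : ℝ) / 57 ≤ dist (x j') (x k''))
    (hADJ : ∀ k'' : Fin N, k'' ≠ j → k'' ≠ k → dist (x j) (x k'') ≤ 1 →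
      (Finset.univ.filter fun l : Fin N =>
        l ≠ j ∧ l ≠ k'' ∧ dist (x j) (x l) ≤ 1 ∧ dist (x k'') (x l) ≤ 1).card = 5 →
      1 < dist (x k) (x k''))
    (w : Fin N)
    (hw : w ∈ (Finset.univ.filter fun l : Fin N =>
        l ≠ j ∧ l ≠ k ∧ dist (x j) (x l) ≤ 1 ∧ dist (x k) (x l) ≤ 1)) :
    (Finset.univ.filter fun l : Fin N =>
        l ≠ j ∧ l ≠ w ∧ dist (x j) (x l) ≤ 1 ∧ dist (x w) (x l) ≤ 1).card ≤ 4 := by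
  classical
  obtain ⟨hwj, hwk, hdjw, hdkw⟩ := (Finset.mem_filter.mp hw).2
  have hle5 := card_common_le_five x j w (Ne.symm hwj) hdjw hsep
  rcases Nat.lt_or_ge (Finset.univ.filter fun l : Fin N =>
      l ≠ j ∧ l ≠ w ∧ dist (x j) (x l) ≤ 1 ∧ dist (x w) (x l) ≤ 1).card 5 with h | h
  · omega
  · exfalso
    have h5 : (Finset.univ.filter fun l : Fin N =>
        l ≠ j ∧ l ≠ w ∧ dist (x j) (x l) ≤ 1 ∧ dist (x w) (x l) ≤ 1).card = 5 := le_antisymm hle5 h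
    exact absurd hdkw (not_le.mpr (hADJ w hwj hwk hdjw h5))

/-- **The `1 + 5 + 5 + 1` partition.**  At a Good site `j` (exactly twelve sites within `1`),
two five-fold bonds `(j, k)`, `(j, k')` with `|x k - x k'| > 1` and disjoint rings exhaust the
neighbourhood: every site within `1` of `x j` other than `j` is `k`, `k'`, or in exactly one of
the two rings. [folklore] -/
theorem mem_rings_of_far_fiveFold {N : ℕ} (x : Fin N → EuclideanSpace ℝ (Fin 3)) (j k k' : Fin N)
    (h12 : (Finset.univ.filter fun j' : Fin N => j' ≠ j ∧ dist (x j) (x j') ≤ 1).card = 12)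
    (hjk : j ≠ k) (hdjk : dist (x j) (x k) ≤ 1)
    (h5 : (Finset.univ.filter fun l : Fin N =>
        l ≠ j ∧ l ≠ k ∧ dist (x j) (x l) ≤ 1 ∧ dist (x k) (x l) ≤ 1).card = 5)
    (hjk' : j ≠ k') (hdjk' : dist (x j) (x k') ≤ 1)
    (h5' : (Finset.univ.filter fun l : Fin N =>
        l ≠ j ∧ l ≠ k' ∧ dist (x j) (x l) ≤ 1 ∧ dist (x k') (x l) ≤ 1).card = 5)
    (hfar : 1 < dist (x k) (x k'))
    (hdisj : Disjoint
      (Finset.univ.filter fun l : Fin N =>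
        l ≠ j ∧ l ≠ k ∧ dist (x j) (x l) ≤ 1 ∧ dist (x k) (x l) ≤ 1)
      (Finset.univ.filter fun l : Fin N =>
        l ≠ j ∧ l ≠ k' ∧ dist (x j) (x l) ≤ 1 ∧ dist (x k') (x l) ≤ 1))
    (l : Fin N) (hlj : l ≠ j) (hdjl : dist (x j) (x l) ≤ 1) :
    l = k ∨ l = k' ∨
      l ∈ (Finset.univ.filter fun l : Fin N =>
        l ≠ j ∧ l ≠ k ∧ dist (x j) (x l) ≤ 1 ∧ dist (x k) (x l) ≤ 1) ∨
      l ∈ (Finset.univ.filter fun l : Fin N =>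
        l ≠ j ∧ l ≠ k' ∧ dist (x j) (x l) ≤ 1 ∧ dist (x k') (x l) ≤ 1) := by
  classical
  set Nj := Finset.univ.filter fun j' : Fin N => j' ≠ j ∧ dist (x j) (x j') ≤ 1 with hNjdef
  set R := Finset.univ.filter fun l : Fin N =>
    l ≠ j ∧ l ≠ k ∧ dist (x j) (x l) ≤ 1 ∧ dist (x k) (x l) ≤ 1 with hRdef
  set R' := Finset.univ.filter fun l : Fin N =>
    l ≠ j ∧ l ≠ k' ∧ dist (x j) (x l) ≤ 1 ∧ dist (x k') (x l) ≤ 1 with hR'def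
  have hmemNj : ∀ a, a ∈ Nj ↔ a ≠ j ∧ dist (x j) (x a) ≤ 1 := fun a => by
    rw [hNjdef, Finset.mem_filter]; exact ⟨fun h => h.2, fun h => ⟨Finset.mem_univ _, h⟩⟩
  have hmemR : ∀ a, a ∈ R ↔ a ≠ j ∧ a ≠ k ∧ dist (x j) (x a) ≤ 1 ∧ dist (x k) (x a) ≤ 1 :=
    fun a => by rw [hRdef, Finset.mem_filter]; exact ⟨fun h => h.2, fun h => ⟨Finset.mem_univ _, h⟩⟩
  have hmemR' : ∀ a, a ∈ R' ↔ a ≠ j ∧ a ≠ k' ∧ dist (x j) (x a) ≤ 1 ∧ dist (x k') (x a) ≤ 1 :=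
    fun a => by rw [hR'def, Finset.mem_filter]; exact ⟨fun h => h.2, fun h => ⟨Finset.mem_univ _, h⟩⟩
  have hkk' : k ≠ k' := fun h => by rw [h, dist_self] at hfar; exact absurd hfar (by norm_num)
  have hkR : k ∉ R := fun h => ((hmemR k).1 h).2.1 rfl
  have hk'R' : k' ∉ R' := fun h => ((hmemR' k').1 h).2.1 rfl
  have hkR' : k ∉ R' := fun h => absurd ((hmemR' k).1 h).2.2.2 (by rw [dist_comm]; exact not_le.mpr hfar)
  have hk'R : k' ∉ R := fun h => absurd ((hmemR k').1 h).2.2.2 (not_le.mpr hfar)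
  -- the union `U = {k, k'} ∪ R ∪ R'` has twelve elements and sits inside `Nj`
  set U := insert k (insert k' (R ∪ R')) with hUdef
  have hUsub : U ⊆ Nj := by
    intro a ha
    rw [hUdef, Finset.mem_insert, Finset.mem_insert, Finset.mem_union] at ha
    rcases ha with rfl | rfl | ha | ha
    · exact (hmemNj _).2 ⟨hjk.symm, hdjk⟩
    · exact (hmemNj _).2 ⟨hjk'.symm, hdjk'⟩
    · exact (hmemNj _).2 ⟨((hmemR a).1 ha).1, ((hmemR a).1 ha).2.2.1⟩
    · exact (hmemNj _).2 ⟨((hmemR' a).1 ha).1, ((hmemR' a).1 ha).2.2.1⟩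
  have hUcard : U.card = 12 := by
    rw [hUdef, Finset.card_insert_of_notMem, Finset.card_insert_of_notMem,
      Finset.card_union_of_disjoint hdisj, h5, h5']
    · rw [Finset.mem_union, not_or]; exact ⟨hk'R, hk'R'⟩
    · rw [Finset.mem_insert, Finset.mem_union, not_or, not_or]; exact ⟨hkk', hkR, hkR'⟩
  have hUeq : U = Nj := Finset.eq_of_subset_of_card_le hUsub (by rw [hUcard, h12])
  have hl : l ∈ U := by rw [hUeq]; exact (hmemNj l).2 ⟨hlj, hdjl⟩
  rw [hUdef, Finset.mem_insert, Finset.mem_insert, Finset.mem_union] at hl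
  exact hl

/-! ## The far case reduced to disjoint rings -/

/-- **(FAR) from (ADJ) and (FAR-disjoint).**  To prove that two non-adjacent five-fold bonds
`(j, k)`, `(j, k')` at a Good site are nearly antipodal (part FAR of
`stub_fiveFoldContinuation`), one may assume in addition — granted part ADJ (no adjacent
five-fold bonds) — that the two rings are disjoint, that no ring site carries a five-fold bond
with `j`, and that the twelve neighbours of `j` are exactly `k`, `k'` and the two rings
(`disjoint_rings_of_noAdjacent`, `card_common_le_four_of_mem_ring`,
`mem_rings_of_far_fiveFold`). [folklore] -/
theorem far_of_noAdjacent_of_farDisjoint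
    (hADJ : ∀ (N : ℕ) (x : Fin N → EuclideanSpace ℝ (Fin 3)) (j k : Fin N),
      ((∀ j' : Fin N, dist (x j) (x j') ≤ 11 / 10 → ∀ k' : Fin N, k' ≠ j' →
          (55 : ℝ) / 57 ≤ dist (x j') (x k')) ∧
        (Finset.univ.filter fun j' : Fin N => j' ≠ j ∧ dist (x j) (x j') ≤ 1).card = 12 ∧
        (Finset.univ.filter fun j' : Fin N => j' ≠ j ∧ dist (x j) (x j') ≤ 11 / 10).card ≤ 12) →
      (∀ l l' : Fin N, dist (x j) (x l) ≤ 1 → dist (x j) (x l') ≤ 1 → 1 < dist (x l) (x l') →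
        (131 : ℝ) / 100 ≤ dist (x l) (x l')) →
      j ≠ k → dist (x j) (x k) ≤ 1 →
      (Finset.univ.filter fun l : Fin N =>
          l ≠ j ∧ l ≠ k ∧ dist (x j) (x l) ≤ 1 ∧ dist (x k) (x l) ≤ 1).card = 5 →
      ∀ k' : Fin N, k' ≠ j → k' ≠ k → dist (x j) (x k') ≤ 1 →
        (Finset.univ.filter fun l : Fin N =>
          l ≠ j ∧ l ≠ k' ∧ dist (x j) (x l) ≤ 1 ∧ dist (x k') (x l) ≤ 1).card = 5 →
        1 < dist (x k) (x k'))
    (hFARD : ∀ (N : ℕ) (x : Fin N → EuclideanSpace ℝ (Fin 3)) (j k : Fin N),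
      ((∀ j' : Fin N, dist (x j) (x j') ≤ 11 / 10 → ∀ k' : Fin N, k' ≠ j' →
          (55 : ℝ) / 57 ≤ dist (x j') (x k')) ∧
        (Finset.univ.filter fun j' : Fin N => j' ≠ j ∧ dist (x j) (x j') ≤ 1).card = 12 ∧
        (Finset.univ.filter fun j' : Fin N => j' ≠ j ∧ dist (x j) (x j') ≤ 11 / 10).card ≤ 12) →
      (∀ l l' : Fin N, dist (x j) (x l) ≤ 1 → dist (x j) (x l') ≤ 1 → 1 < dist (x l) (x l') →
        (131 : ℝ) / 100 ≤ dist (x l) (x l')) →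
      j ≠ k → dist (x j) (x k) ≤ 1 →
      (Finset.univ.filter fun l : Fin N =>
          l ≠ j ∧ l ≠ k ∧ dist (x j) (x l) ≤ 1 ∧ dist (x k) (x l) ≤ 1).card = 5 →
      ∀ k' : Fin N, k' ≠ j → dist (x j) (x k') ≤ 1 →
        (Finset.univ.filter fun l : Fin N =>
          l ≠ j ∧ l ≠ k' ∧ dist (x j) (x l) ≤ 1 ∧ dist (x k') (x l) ≤ 1).card = 5 →
        1 < dist (x k) (x k') →
        Disjoint (Finset.univ.filter fun l : Fin N =>
          l ≠ j ∧ l ≠ k ∧ dist (x j) (x l) ≤ 1 ∧ dist (x k) (x l) ≤ 1)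
          (Finset.univ.filter fun l : Fin N =>
          l ≠ j ∧ l ≠ k' ∧ dist (x j) (x l) ≤ 1 ∧ dist (x k') (x l) ≤ 1) →
        (∀ w ∈ (Finset.univ.filter fun l : Fin N =>
          l ≠ j ∧ l ≠ k ∧ dist (x j) (x l) ≤ 1 ∧ dist (x k) (x l) ≤ 1),
          (Finset.univ.filter fun l : Fin N =>
          l ≠ j ∧ l ≠ w ∧ dist (x j) (x l) ≤ 1 ∧ dist (x w) (x l) ≤ 1).card ≤ 4) →
        (∀ w ∈ (Finset.univ.filter fun l : Fin N =>
          l ≠ j ∧ l ≠ k' ∧ dist (x j) (x l) ≤ 1 ∧ dist (x k') (x l) ≤ 1),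
          (Finset.univ.filter fun l : Fin N =>
          l ≠ j ∧ l ≠ w ∧ dist (x j) (x l) ≤ 1 ∧ dist (x w) (x l) ≤ 1).card ≤ 4) →
        (∀ l : Fin N, l ≠ j → dist (x j) (x l) ≤ 1 → l = k ∨ l = k' ∨
          l ∈ (Finset.univ.filter fun l : Fin N =>
          l ≠ j ∧ l ≠ k ∧ dist (x j) (x l) ≤ 1 ∧ dist (x k) (x l) ≤ 1) ∨
          l ∈ (Finset.univ.filter fun l : Fin N =>
          l ≠ j ∧ l ≠ k' ∧ dist (x j) (x l) ≤ 1 ∧ dist (x k') (x l) ≤ 1)) →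
        inner ℝ (x k - x j) (x k' - x j) ≤ -((19 : ℝ) / 20) * (‖x k - x j‖ * ‖x k' - x j‖)) :
    ∀ (N : ℕ) (x : Fin N → EuclideanSpace ℝ (Fin 3)) (j k : Fin N),
      ((∀ j' : Fin N, dist (x j) (x j') ≤ 11 / 10 → ∀ k' : Fin N, k' ≠ j' →
          (55 : ℝ) / 57 ≤ dist (x j') (x k')) ∧
        (Finset.univ.filter fun j' : Fin N => j' ≠ j ∧ dist (x j) (x j') ≤ 1).card = 12 ∧
        (Finset.univ.filter fun j' : Fin N => j' ≠ j ∧ dist (x j) (x j') ≤ 11 / 10).card ≤ 12) →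
      (∀ l l' : Fin N, dist (x j) (x l) ≤ 1 → dist (x j) (x l') ≤ 1 → 1 < dist (x l) (x l') →
        (131 : ℝ) / 100 ≤ dist (x l) (x l')) →
      j ≠ k → dist (x j) (x k) ≤ 1 →
      (Finset.univ.filter fun l : Fin N =>
          l ≠ j ∧ l ≠ k ∧ dist (x j) (x l) ≤ 1 ∧ dist (x k) (x l) ≤ 1).card = 5 →
      ∀ k' : Fin N, k' ≠ j → dist (x j) (x k') ≤ 1 →
        (Finset.univ.filter fun l : Fin N =>
          l ≠ j ∧ l ≠ k' ∧ dist (x j) (x l) ≤ 1 ∧ dist (x k') (x l) ≤ 1).card = 5 →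
        1 < dist (x k) (x k') →
        inner ℝ (x k - x j) (x k' - x j) ≤ -((19 : ℝ) / 20) * (‖x k - x j‖ * ‖x k' - x j‖) := by
  classical
  intro N x j k hGood hDich hjk hdjk h5 k' hk'j hdjk' h5' hfar
  have hADJk := hADJ N x j k hGood hDich hjk hdjk h5
  have hADJk' := hADJ N x j k' hGood hDich hk'j.symm hdjk' h5'
  have hkk' : k' ≠ k := fun h => by rw [h, dist_self] at hfar; exact absurd hfar (by norm_num)
  have hdisj := disjoint_rings_of_noAdjacent x j k k' hGood.1 hDich hjk hdjk h5 hADJk hk'j.symm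
    hdjk' h5' hkk'
  exact hFARD N x j k hGood hDich hjk hdjk h5 k' hk'j hdjk' h5' hfar hdisj
    (fun w hw => card_common_le_four_of_mem_ring x j k hGood.1 hADJk w hw)
    (fun w hw => card_common_le_four_of_mem_ring x j k' hGood.1 hADJk' w hw)
    (fun l hlj hdjl => mem_rings_of_far_fiveFold x j k k' hGood.2.1 hjk hdjk h5 hk'j.symm hdjk'
      h5' hfar hdisj l hlj hdjl)

/-- Registered sub-goal form (closed statement) of `far_of_noAdjacent_of_farDisjoint`: parts
(ADJ) and (FAR-disjoint) imply part (FAR) of `stub_fiveFoldContinuation` (S2β, line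
`Sketch`). [folklore] -/
theorem stub_farOfFarDisjoint :
    (∀ (N : ℕ) (x : Fin N → EuclideanSpace ℝ (Fin 3)) (j k : Fin N),
      ((∀ j' : Fin N, dist (x j) (x j') ≤ 11 / 10 → ∀ k' : Fin N, k' ≠ j' →
          (55 : ℝ) / 57 ≤ dist (x j') (x k')) ∧
        (Finset.univ.filter fun j' : Fin N => j' ≠ j ∧ dist (x j) (x j') ≤ 1).card = 12 ∧
        (Finset.univ.filter fun j' : Fin N => j' ≠ j ∧ dist (x j) (x j') ≤ 11 / 10).card ≤ 12) →
      (∀ l l' : Fin N, dist (x j) (x l) ≤ 1 → dist (x j) (x l') ≤ 1 → 1 < dist (x l) (x l') →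
        (131 : ℝ) / 100 ≤ dist (x l) (x l')) →
      j ≠ k → dist (x j) (x k) ≤ 1 →
      (Finset.univ.filter fun l : Fin N =>
          l ≠ j ∧ l ≠ k ∧ dist (x j) (x l) ≤ 1 ∧ dist (x k) (x l) ≤ 1).card = 5 →
      ∀ k' : Fin N, k' ≠ j → k' ≠ k → dist (x j) (x k') ≤ 1 →
        (Finset.univ.filter fun l : Fin N =>
          l ≠ j ∧ l ≠ k' ∧ dist (x j) (x l) ≤ 1 ∧ dist (x k') (x l) ≤ 1).card = 5 →
        1 < dist (x k) (x k')) →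
    (∀ (N : ℕ) (x : Fin N → EuclideanSpace ℝ (Fin 3)) (j k : Fin N),
      ((∀ j' : Fin N, dist (x j) (x j') ≤ 11 / 10 → ∀ k' : Fin N, k' ≠ j' →
          (55 : ℝ) / 57 ≤ dist (x j') (x k')) ∧
        (Finset.univ.filter fun j' : Fin N => j' ≠ j ∧ dist (x j) (x j') ≤ 1).card = 12 ∧
        (Finset.univ.filter fun j' : Fin N => j' ≠ j ∧ dist (x j) (x j') ≤ 11 / 10).card ≤ 12) →
      (∀ l l' : Fin N, dist (x j) (x l) ≤ 1 → dist (x j) (x l') ≤ 1 → 1 < dist (x l) (x l') →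
        (131 : ℝ) / 100 ≤ dist (x l) (x l')) →
      j ≠ k → dist (x j) (x k) ≤ 1 →
      (Finset.univ.filter fun l : Fin N =>
          l ≠ j ∧ l ≠ k ∧ dist (x j) (x l) ≤ 1 ∧ dist (x k) (x l) ≤ 1).card = 5 →
      ∀ k' : Fin N, k' ≠ j → dist (x j) (x k') ≤ 1 →
        (Finset.univ.filter fun l : Fin N =>
          l ≠ j ∧ l ≠ k' ∧ dist (x j) (x l) ≤ 1 ∧ dist (x k') (x l) ≤ 1).card = 5 →
        1 < dist (x k) (x k') →
        Disjoint (Finset.univ.filter fun l : Fin N =>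
          l ≠ j ∧ l ≠ k ∧ dist (x j) (x l) ≤ 1 ∧ dist (x k) (x l) ≤ 1)
          (Finset.univ.filter fun l : Fin N =>
          l ≠ j ∧ l ≠ k' ∧ dist (x j) (x l) ≤ 1 ∧ dist (x k') (x l) ≤ 1) →
        (∀ w ∈ (Finset.univ.filter fun l : Fin N =>
          l ≠ j ∧ l ≠ k ∧ dist (x j) (x l) ≤ 1 ∧ dist (x k) (x l) ≤ 1),
          (Finset.univ.filter fun l : Fin N =>
          l ≠ j ∧ l ≠ w ∧ dist (x j) (x l) ≤ 1 ∧ dist (x w) (x l) ≤ 1).card ≤ 4) →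
        (∀ w ∈ (Finset.univ.filter fun l : Fin N =>
          l ≠ j ∧ l ≠ k' ∧ dist (x j) (x l) ≤ 1 ∧ dist (x k') (x l) ≤ 1),
          (Finset.univ.filter fun l : Fin N =>
          l ≠ j ∧ l ≠ w ∧ dist (x j) (x l) ≤ 1 ∧ dist (x w) (x l) ≤ 1).card ≤ 4) →
        (∀ l : Fin N, l ≠ j → dist (x j) (x l) ≤ 1 → l = k ∨ l = k' ∨
          l ∈ (Finset.univ.filter fun l : Fin N =>
          l ≠ j ∧ l ≠ k ∧ dist (x j) (x l) ≤ 1 ∧ dist (x k) (x l) ≤ 1) ∨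
          l ∈ (Finset.univ.filter fun l : Fin N =>
          l ≠ j ∧ l ≠ k' ∧ dist (x j) (x l) ≤ 1 ∧ dist (x k') (x l) ≤ 1)) →
        inner ℝ (x k - x j) (x k' - x j) ≤ -((19 : ℝ) / 20) * (‖x k - x j‖ * ‖x k' - x j‖)) →
    ∀ (N : ℕ) (x : Fin N → EuclideanSpace ℝ (Fin 3)) (j k : Fin N),
      ((∀ j' : Fin N, dist (x j) (x j') ≤ 11 / 10 → ∀ k' : Fin N, k' ≠ j' →
          (55 : ℝ) / 57 ≤ dist (x j') (x k')) ∧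
        (Finset.univ.filter fun j' : Fin N => j' ≠ j ∧ dist (x j) (x j') ≤ 1).card = 12 ∧
        (Finset.univ.filter fun j' : Fin N => j' ≠ j ∧ dist (x j) (x j') ≤ 11 / 10).card ≤ 12) →
      (∀ l l' : Fin N, dist (x j) (x l) ≤ 1 → dist (x j) (x l') ≤ 1 → 1 < dist (x l) (x l') →
        (131 : ℝ) / 100 ≤ dist (x l) (x l')) →
      j ≠ k → dist (x j) (x k) ≤ 1 →
      (Finset.univ.filter fun l : Fin N =>
          l ≠ j ∧ l ≠ k ∧ dist (x j) (x l) ≤ 1 ∧ dist (x k) (x l) ≤ 1).card = 5 →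
      ∀ k' : Fin N, k' ≠ j → dist (x j) (x k') ≤ 1 →
        (Finset.univ.filter fun l : Fin N =>
          l ≠ j ∧ l ≠ k' ∧ dist (x j) (x l) ≤ 1 ∧ dist (x k') (x l) ≤ 1).card = 5 →
        1 < dist (x k) (x k') →
        inner ℝ (x k - x j) (x k' - x j) ≤ -((19 : ℝ) / 20) * (‖x k - x j‖ * ‖x k' - x j‖) :=
  fun hADJ hFARD => far_of_noAdjacent_of_farDisjoint hADJ hFARD

end Summit.AtomisticToContinuum.Crystallization.Theorems.SquareWellLayerCakeGapTwelveToBarlow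

end
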